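import Mathlib
import HarnessLib
import Literature.MathematicalPhysics.QuantumLattice.TorusShellCountRegularBand
import Literature.MathematicalPhysics.QuantumLattice.InfraredCutoffGramConstantLargeVolume
import Summits.HubbardSuperconductivity.HubbardSuperconductivity.Theorems.KLProgrammeKLRegimeScaleZeroDetBoundLargeL

/-!
# Route `KLProgramme`, ENGINE child (stmt-…-20437), scale `0` AT THE BARE FRAME `K₀ = 0`: the determinant / replica-Gram constant of the
# scale-`0` covariance is `√46` on the window `klWindowC`, under the engine's volume threshold

Cell gate-hubbard-kl, seat p1 (g18); brick D3 of the located item #22 «(C)-SCALE0-NATURAL» (memo SCALE0-REMAINDER-BUDGET, evidence on 20437).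
At `n = 0` the flow frame is `K₀ = klFlowFrameU … 0 = 0` (`rfl`), so the band of the scale-`0` covariance is the FREE band
`ξ(k⃗) = -2(cos p₁ + cos p₂) - μ` (`nambuXiCT_zero_frame`).  For `μ ∈ klWindowC = [-1.05, -0.15]` and `|ξ| ≤ 1/32 = e₀` the free Fermi
annulus stays away from the band bottom and the van Hove points: of the two coordinate speeds `|2 sin p₁|`, `|2 sin p₂|` one is `≥ 16/25`
(`freeBand_coord_steep`: else both `cos² > 0.8976`, and the three sign patterns of `(cos p₁, cos p₂)` contradict
`cos p₁ + cos p₂ = -(μ+ξ)/2 ∈ [0.059, 0.541]`).  Salmhofer's line-piece count (`Literature/…/TorusShellCountRegularBand.card_le_of_coordFloor`)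
with coordinate data `(Kc, c₀, N) = (2, 16/25, 40)` (`4π·2 ≤ (16/25)·40`) then gives the FREE-band level count

  `#{k⃗ ∈ (ℤ/Lℤ)² : |ξ(p_k⃗)| < η} ≤ (160/(0.64π))·η·L² + 80·L`   (`0 < η ≤ e₀`, every `L ≥ 1`, every `μ ∈ klWindowC`)

— `c₁ ≈ 79.6` in place of the frame-uniform GeomConstants count's `1793` — hence, through the large-volume Pedra–Salmhofer phase-space sum
(`InfraredCutoffGramConstantLargeVolume`), the infrared Gram constant `κ_IR² ≤ (20/π)·c₁/32 + 10⁻³ = 156.25/π² + 10⁻³ ≤ 16` once `2¹⁰β² ≤ L`, and the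
scale-`0` determinant constant **`δ₀² = 2(7 + 16) = 46`** (`…LargeL`: 728 frame-uniform; of record: 12108 / 3213478):

* `freeBand_coord_steep`, `card_freeLevel_lt_le` (the count), `infraredGram_free_le_largeVolume`, `infraredGram_free_scaleZero_le_largeL` (`≤ 16`);
* **`isDetBoundedR_scaleZero_free_largeL`** / **`isGramBoundedR_scaleZero_free_largeL`** — `IsDetBoundedR q (Sᵀ·C⁰_{>e₀}·S) √(2·(7+16))` at the bare
  frame, `μ ∈ klWindowC`, `klBetaMin ≤ β`, `2¹⁰β² ≤ L`, every `M ≥ 1`; **`…_klEngL₃`** twins under the stub binder `klEngL₃ β U ≤ L`.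

Bare frame only (the n ≥ 1 frames keep the frame-uniform `√728`); no definition, no frozen token touched.  Everything PROVED. [folklore]
-/

noncomputable section

-- the tree's namespace `Summit.<Summit>.<Problem>.Theorems` repeats the summit name by design (D-0017)
set_option linter.dupNamespace false

namespace Summit.HubbardSuperconductivity.HubbardSuperconductivity.Theorems.KLRegimeSplit

open Real Finset Literature.MathematicalPhysics.QuantumLattice Literature.Probability.LatticeModels
open Literature.MathematicalPhysics.QuantumLattice.FermiRG

variable {L : ℕ} [NeZero L]

/-- `|2 sin t - 2 sin t'| ≤ 2|t - t'|`. -/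
theorem abs_two_sin_sub_two_sin_le (t t' : ℝ) : |2 * Real.sin t - 2 * Real.sin t'| ≤ 2 * |t - t'| := by
  have h : |Real.sin t - Real.sin t'| ≤ |t - t'| := by
    simpa [Real.dist_eq] using Real.lipschitzWith_sin.dist_le_mul t t'
  rw [← mul_sub, abs_mul, abs_two]
  linarith

omit [NeZero L] in
/-- **The free Fermi annulus is coordinate-steep on the window**: for `μ ∈ klWindowC` and `|−2(cos p₁ + cos p₂) − μ| ≤ 1/32`,
`16/25 ≤ |2 sin p₁|` or `16/25 ≤ |2 sin p₂|`. -/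
theorem freeBand_coord_steep {μ : ℝ} (hμ : μ ∈ klWindowC) (p : Fin 2 → ℝ)
    (hp : |-2 * (Real.cos (p 0) + Real.cos (p 1)) - μ| ≤ 1 / 32) :
    (16 / 25 : ℝ) ≤ |2 * Real.sin (p 0)| ∨ (16 / 25 : ℝ) ≤ |2 * Real.sin (p 1)| := by
  rcases hμ with ⟨hμ1, hμ2⟩
  by_contra h
  push Not at h
  obtain ⟨h0, h1⟩ := h
  set a := Real.cos (p 0) with ha
  set b := Real.cos (p 1) with hb
  have hs0 : Real.sin (p 0) ^ 2 < 0.1024 := by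
    have : |Real.sin (p 0)| < 0.32 := by
      have := abs_mul (2 : ℝ) (Real.sin (p 0)); rw [abs_two] at this; linarith
    have h' := abs_lt.1 this
    nlinarith
  have hs1 : Real.sin (p 1) ^ 2 < 0.1024 := by
    have : |Real.sin (p 1)| < 0.32 := by
      have := abs_mul (2 : ℝ) (Real.sin (p 1)); rw [abs_two] at this; linarith
    have h' := abs_lt.1 this
    nlinarith
  have ha2 : 0.8976 < a ^ 2 := by have := Real.sin_sq_add_cos_sq (p 0); rw [← ha] at this; linarith
  have hb2 : 0.8976 < b ^ 2 := by have := Real.sin_sq_add_cos_sq (p 1); rw [← hb] at this; linarith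
  have ha1 : a ≤ 1 := Real.cos_le_one _
  have hb1 : b ≤ 1 := Real.cos_le_one _
  have ha1' : -1 ≤ a := Real.neg_one_le_cos _
  have hb1' : -1 ≤ b := Real.neg_one_le_cos _
  have hsum := abs_le.1 hp
  -- `a + b ∈ [0.059, 0.541]`
  have hlo : 0.059 ≤ a + b := by linarith
  have hhi : a + b ≤ 0.541 := by linarith
  -- sign cases
  rcases le_or_gt 0 a with ha0 | ha0 <;> rcases le_or_gt 0 b with hb0 | hb0
  · -- both nonnegative: each `> 0.947`
    have : 0.947 < a := by nlinarith
    have : 0.947 < b := by nlinarith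
    linarith
  · have : b < -0.947 := by nlinarith
    linarith
  · have : a < -0.947 := by nlinarith
    linarith
  · linarith

/-- **The FREE-band level count on the window**: for `μ ∈ klWindowC`, `0 < η ≤ klE0 = 1/32` and every side `L ≥ 1`,
`#{k⃗ ∈ (ℤ/Lℤ)² : |ξ_μ(k⃗)| < η} ≤ (4·40/(π·(16/25)))·η·L² + 2·40·L` (`ξ_μ = nambuXiCT L μ 0`; Salmhofer's line pieces with `(Kc, c₀, N) = (2, 16/25, 40)`). -/
theorem card_freeLevel_lt_le {μ : ℝ} (hμ : μ ∈ klWindowC) {η : ℝ} (hη : 0 < η) (hηe : η ≤ klE0) :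
    (((univ : Finset (TorusSite 2 L)).filter fun k => |nambuXiCT L μ 0 k| < η).card : ℝ) ≤
      4 * (40 : ℕ) / (π * (16 / 25)) * η * (L : ℝ) ^ 2 + 2 * (40 : ℕ) * L := by
  set e : (Fin 2 → ℝ) → ℝ := fun p => -2 * (Real.cos (p 0) + Real.cos (p 1)) - μ with he
  set de : Fin 2 → (Fin 2 → ℝ) → ℝ := fun j p => 2 * Real.sin (p j) with hde
  have hband : ∀ k : TorusSite 2 L, nambuXiCT L μ 0 k = e (latticeMomentum L k) := by
    intro k
    rw [nambuXiCT_zero_frame, nambuXi, torusBand, Fin.sum_univ_two, he]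
  refine card_le_of_coordFloor (L := L) e de (Kc := 2) (c₀ := 16 / 25) (η := η) (by norm_num) (by norm_num) hη.le
    ?_ ?_ ?_ ?_ _ ?_ ?_ (N := 40) (by norm_num) ?_
  · intro y t
    have h : HasDerivAt (fun s : ℝ => -2 * (Real.cos s + Real.cos y) - μ) (2 * Real.sin t) t := by
      have := ((Real.hasDerivAt_cos t).add_const (Real.cos y)).const_mul (-2 : ℝ)
      simpa using this.sub_const μ
    simpa [he, hde] using h
  · intro x t
    have h : HasDerivAt (fun s : ℝ => -2 * (Real.cos x + Real.cos s) - μ) (2 * Real.sin t) t := by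
      have := ((Real.hasDerivAt_cos t).const_add (Real.cos x)).const_mul (-2 : ℝ)
      simpa using this.sub_const μ
    simpa [he, hde] using h
  · intro y t t'; simpa [hde] using abs_two_sin_sub_two_sin_le t t'
  · intro x t t'; simpa [hde] using abs_two_sin_sub_two_sin_le t t'
  · intro k hk
    rw [← hband]
    exact (mem_filter.1 hk).2.le
  · intro k hk
    have hsmall : |e (latticeMomentum L k)| ≤ 1 / 32 := by
      rw [← hband]; exact ((mem_filter.1 hk).2.le.trans hηe).trans (by norm_num [klE0])
    simpa [hde] using freeBand_coord_steep hμ (latticeMomentum L k) (by simpa [he] using hsmall)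
  · have := Real.pi_lt_d2
    push_cast
    nlinarith

/-- **The infrared phase-space sum at the bare frame, large-volume form**: for `μ ∈ klWindowC`, `0 < β`, `π/β ≤ Λ ≤ klE0`, every `L ≥ 1`, every `M`:
`Σ_{(ω,k⃗)} (1 - w⁰_Λ)/√(ω² + ξ²) ≤ (20/π)c₁ΛβL² + (8/π²)·80·Λβ²L + (24/π)·80·βL`, `c₁ = 160/(π·16/25)`. -/
theorem infraredGram_free_le_largeVolume {M : ℕ} {μ : ℝ} (hμ : μ ∈ klWindowC) {β Λ : ℝ} (hβ : 0 < β) (hΛ : 0 < Λ)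
    (hΛβ : Real.pi / β ≤ Λ) (hΛe : Λ ≤ klE0) :
    ∑ k : FreqMomentum L M, (1 - hubbardCutoffWeightCT L M β μ 0 Λ k) /
        Real.sqrt (matsubaraFreq β M k.1 ^ 2 + nambuXiCT L μ 0 k.2 ^ 2) ≤
      20 / Real.pi * (4 * (40 : ℕ) / (π * (16 / 25))) * Λ * β * (L : ℝ) ^ 2 +
        8 / Real.pi ^ 2 * (2 * (40 : ℕ)) * Λ * β ^ 2 * L + 24 / Real.pi * (2 * (40 : ℕ)) * β * L :=
  sum_one_sub_hubbardCutoffWeightCT_div_sqrt_le_largeVolume hβ μ 0 hΛ hΛβ (by positivity) (by positivity)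
    fun η hη hηΛ => card_freeLevel_lt_le hμ hη (hηΛ.trans hΛe)

/-- **At the bare frame the scale-`0` infrared Gram constant is `≤ 16` once `2¹⁰β² ≤ L`** (`(20/π)·c₁/32 = 156.25/π² ≤ 15.84`, rounding terms
`≤ 10⁻²`): `μ ∈ klWindowC`, `klBetaMin ≤ β`, `2¹⁰·β² ≤ L`, every `M`. -/
theorem infraredGram_free_scaleZero_le_largeL {M : ℕ} {μ : ℝ} (hμ : μ ∈ klWindowC) {β : ℝ} (hβ : klBetaMin ≤ β)
    (hL : (2 : ℝ) ^ 10 * β ^ 2 ≤ L) :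
    1 / (β * (L : ℝ) ^ 2) * ∑ k : FreqMomentum L M,
      (1 - hubbardCutoffWeightCT L M β μ 0 klE0 k) / Real.sqrt (matsubaraFreq β M k.1 ^ 2 + nambuXiCT L μ 0 k.2 ^ 2) ≤ 16 := by
  have h128 : (128 : ℝ) ≤ β := by simpa [klBetaMin] using hβ
  have hβpos : 0 < β := by linarith
  have hLpos : (0 : ℝ) < L := by exact_mod_cast Nat.pos_of_ne_zero (NeZero.ne L)
  have he₀ : (0 : ℝ) < klE0 := by norm_num [klE0]
  have hπβ : Real.pi / β ≤ klE0 := by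
    rw [div_le_iff₀ hβpos, klE0]
    nlinarith [Real.pi_lt_four]
  have hsum := infraredGram_free_le_largeVolume (L := L) (M := M) hμ hβpos he₀ hπβ le_rfl
  have hβL2 : 0 < β * (L : ℝ) ^ 2 := by positivity
  rw [one_div, inv_mul_le_iff₀ hβL2]
  refine hsum.trans ?_
  set q : ℝ := Real.pi⁻¹ with hq
  have hπ := Real.pi_gt_d6
  have hq0 : 0 < q := by rw [hq]; exact inv_pos.2 Real.pi_pos
  have hq1 : q ≤ 0.31831 := by
    rw [hq, inv_le_comm₀ Real.pi_pos (by norm_num)]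
    have : (1 : ℝ) / 0.31831 ≤ 3.141592 := by norm_num
    rw [one_div] at this
    linarith
  have e1 : 20 / Real.pi * (4 * ((40 : ℕ) : ℝ) / (π * (16 / 25))) * klE0 * β * (L : ℝ) ^ 2 +
        8 / Real.pi ^ 2 * (2 * ((40 : ℕ) : ℝ)) * klE0 * β ^ 2 * L + 24 / Real.pi * (2 * ((40 : ℕ) : ℝ)) * β * L =
      (20 * (4 * 40) / (16 / 25) / 32) * q ^ 2 * (β * (L : ℝ) ^ 2) + (8 * 80 / 32) * q ^ 2 * β * (β * L) +
        (24 * 80) * q * (β * L) := by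
    simp only [hq, klE0, div_eq_mul_inv]
    push_cast
    ring
  rw [e1]
  have c1 : (20 * (4 * 40) / (16 / 25) / 32 : ℝ) * q ^ 2 ≤ 15.84 := by nlinarith
  have c2 : (8 * 80 / 32 : ℝ) * q ^ 2 ≤ 2.03 := by nlinarith
  have c3 : (24 * 80 : ℝ) * q ≤ 611.2 := by nlinarith
  have hβL : 0 < β * (L : ℝ) := by positivity
  have t1 : (20 * (4 * 40) / (16 / 25) / 32 : ℝ) * q ^ 2 * (β * (L : ℝ) ^ 2) ≤ 15.84 * (β * (L : ℝ) ^ 2) :=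
    mul_le_mul_of_nonneg_right c1 hβL2.le
  have t2 : (8 * 80 / 32 : ℝ) * q ^ 2 * β * (β * L) ≤ 2.03 * β * (β * L) := by
    have := mul_le_mul_of_nonneg_right c2 (mul_nonneg hβpos.le hβL.le)
    nlinarith
  have t3 : (24 * 80 : ℝ) * q * (β * L) ≤ 611.2 * (β * L) := mul_le_mul_of_nonneg_right c3 hβL.le
  have hslack : 2.03 * β * (β * L) + 611.2 * (β * L) ≤ 0.16 * (β * (L : ℝ) ^ 2) := by
    have h1 : 2.03 * β + 611.2 ≤ 0.16 * (L : ℝ) := by nlinarith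
    have h2 : 2.03 * β * (β * L) + 611.2 * (β * L) = (2.03 * β + 611.2) * (β * L) := by ring
    have h3 : 0.16 * (β * (L : ℝ) ^ 2) = (0.16 * L) * (β * L) := by ring
    rw [h2, h3]
    exact mul_le_mul_of_nonneg_right h1 hβL.le
  linarith

/-- **At the bare frame the scale-`0` covariance is determinant-bounded with `δ₀ = √(2·(7+16)) = √46` on the window** (vs the frame-uniform
`√728` of `isDetBoundedR_scaleZero_of_frameOK_largeL` and the `√12108` of record): `μ ∈ klWindowC`, `klBetaMin ≤ β`, `2¹⁰β² ≤ L`, every `M ≥ 1`. -/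
theorem isDetBoundedR_scaleZero_free_largeL {μ : ℝ} (hμ : μ ∈ klWindowC) {β : ℝ} (hβ : klBetaMin ≤ β) {M : ℕ} [NeZero M]
    (hL : (2 : ℝ) ^ 10 * β ^ 2 ≤ L) :
    IsDetBoundedR (fun X : GridLeg (GridPoint L (2 * (2 * M))) => decide (X.2 = 0))
      ((hubbardGridSub L M β (2 * (2 * M))).transpose * hubbardCovAboveCT L M β μ 0 0 klE0 *
        hubbardGridSub L M β (2 * (2 * M)))
      (Real.sqrt (2 * (7 + 16))) := by
  have hβpos : 0 < β := lt_of_lt_of_le (by norm_num [klBetaMin]) hβ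
  have hκ : 1 / (β * (L : ℝ) ^ 2) * ∑ k : FreqMomentum L M,
      (1 - hubbardCutoffWeightCT L M β μ 0 klE0 k) / Real.sqrt (matsubaraFreq β M k.1 ^ 2 + nambuXiCT L μ 0 k.2 ^ 2) ≤
        (Real.sqrt 16) ^ 2 := by
    rw [Real.sq_sqrt (by norm_num)]
    exact infraredGram_free_scaleZero_le_largeL (L := L) (M := M) hμ hβ hL
  have h := isDetBoundedR_gridSub_hubbardCovAboveCT (L := L) (M := M) hβpos μ 0 klE0 hκ
  rwa [Real.sq_sqrt (by norm_num)] at h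

/-- **Replica-Gram form at the bare frame**: `IsGramBoundedR (Sᵀ·C⁰_{>e₀}·S) √(2·(7+16))` for `μ ∈ klWindowC`, `klBetaMin ≤ β`, `2¹⁰β² ≤ L`, every `M ≥ 1`. -/
theorem isGramBoundedR_scaleZero_free_largeL {μ : ℝ} (hμ : μ ∈ klWindowC) {β : ℝ} (hβ : klBetaMin ≤ β) {M : ℕ} [NeZero M]
    (hL : (2 : ℝ) ^ 10 * β ^ 2 ≤ L) :
    IsGramBoundedR
      ((hubbardGridSub L M β (2 * (2 * M))).transpose * hubbardCovAboveCT L M β μ 0 0 klE0 *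
        hubbardGridSub L M β (2 * (2 * M)))
      (Real.sqrt (2 * (7 + 16))) :=
  (isDetBoundedR_scaleZero_free_largeL (L := L) hμ hβ hL).isGramBoundedR
    (fun _ _ h => EngineV8.gridSub_hubbardCovAboveCT_apply_of_charge_eq β μ 0 klE0 (2 * (2 * M)) h) (Real.sqrt_nonneg _)

/-- **`δ₀ = √46` at the bare frame under the engine stub's binder `klEngL₃ β U ≤ L`.** -/
theorem isDetBoundedR_scaleZero_free_klEngL₃ {μ : ℝ} (hμ : μ ∈ klWindowC) {β U : ℝ} (hβ : klBetaMin ≤ β) {M : ℕ} [NeZero M]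
    (hL : EngineV8.klEngL₃ β U ≤ L) :
    IsDetBoundedR (fun X : GridLeg (GridPoint L (2 * (2 * M))) => decide (X.2 = 0))
      ((hubbardGridSub L M β (2 * (2 * M))).transpose * hubbardCovAboveCT L M β μ 0 0 klE0 *
        hubbardGridSub L M β (2 * (2 * M)))
      (Real.sqrt (2 * (7 + 16))) :=
  isDetBoundedR_scaleZero_free_largeL hμ hβ (sq_le_of_klEngL₃_le hL)

/-- **Replica-Gram form at the bare frame under `klEngL₃ β U ≤ L`.** -/
theorem isGramBoundedR_scaleZero_free_klEngL₃ {μ : ℝ} (hμ : μ ∈ klWindowC) {β U : ℝ} (hβ : klBetaMin ≤ β) {M : ℕ} [NeZero M]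
    (hL : EngineV8.klEngL₃ β U ≤ L) :
    IsGramBoundedR
      ((hubbardGridSub L M β (2 * (2 * M))).transpose * hubbardCovAboveCT L M β μ 0 0 klE0 *
        hubbardGridSub L M β (2 * (2 * M)))
      (Real.sqrt (2 * (7 + 16))) :=
  isGramBoundedR_scaleZero_free_largeL hμ hβ (sq_le_of_klEngL₃_le hL)

end Summit.HubbardSuperconductivity.HubbardSuperconductivity.Theorems.KLRegimeSplit

end
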